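import Literature.NumberTheory.Automorphic.CuspidalCohomologyArchCoeff
import Literature.NumberTheory.Automorphic.ResGLnArchCoefficientModule
import HarnessLib

/-!
# `H^q(𝔤, K_∞; π ⊗ E)` as a Hecke module over `GL_n(𝔸_F^∞)`, for an automorphic representation `π` of
# `GL_n(𝔸_F)` and ANY coefficient `(𝔤, K_∞)`-module `E`

Topic `NumberTheory/Automorphic`; namespace `Literature.NumberTheory.Automorphic.AutomorphicRepData`.
Definitions with bodies and theorems; no named fact, no instance, no `sorry`.

`CuspidalCohomologyArchCoeff` turns the generic `AutomorphicRepData.gkCohomologyWith / cohomologyRepWith`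
(`AutomorphicRepCohomologyCoeff`) into the `GL_n(𝔸_F^∞)`-Hecke module
`H^q(𝔤, K_∞; π ⊗ E_wt(ℂ))^U` for a cuspidal `π` and the PARALLEL-weight coefficients
`E_wt(ℂ) = ParallelWeight.archCoeffRep F n wt`.  The Eichler–Shimura–Borel realisation of cuspidal
representations in the cohomology of `Res_{F/ℚ} GL_n` (`ResGLnCohomology.cuspidalEigenclass_exists`,
Clozel's Lemme 3.15) needs the same Hecke module for other coefficient `(𝔤, K_∞)`-modules of
`G_∞ = GL_n(F_∞)`: the general-weight modules `E_λ(ℂ) = ResGLnCohomology.archCoeffRep n F λ`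
(`ResGLnArchCoefficientModule`) and their sign twists `E_λ ⊗ ε_S` [cite: Clozel1990, Lemme 3.14–3.15]
[cite: GrobnerRaghuram2014, §6 Rem. 27, §7.1].  THIS FILE carries out the (one-screen) construction
ONCE for an arbitrary coefficient `(𝔤, K_∞)`-module `E = (σK, σ𝔤)` (only the compatibility
`σK k ∘ σ𝔤 X ∘ σK k⁻¹ = σ𝔤 (Ad k X)` is used, as the hypothesis `hE`) and ANY automorphic
`π = W / W'` of `GL_n(𝔸_F)` (Borel–Jacquet model, cuspidality is not used):

* `π.cohomologyGL σK σ𝔤 hE q = H^q(𝔤, K_∞; π ⊗ E)` — `gkCohomologyWith` at the regular datum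
  `AutomorphyDatum.gl n F hcpt` (`AutomorphyDatum.isRegular_gl`) with the Lie action `π.lieRep`
  (`hasLieAction_lieRep`) [cite: BorelWallach2000, I §5.1; VII §2];
* `π.cohomologyGLRep σK σ𝔤 hE q` — **the representation of `GL_n(𝔸_F^∞)` on it** (`cohomologyRepWith`,
  `r(h) ⊗ 1` on cochains, transported along `GLn.ofFinite`), `cohomologyGLRep_apply`, and
  `cohomologyGLRep_isSmooth` — **it is smooth** [cite: BorelJacquet1979, 4.6 with 4.2(a), 4.3];
* `π.cohomologyGLLevel σK σ𝔤 hE U q = H^q(𝔤, K_∞; π ⊗ E)^U`, the Hecke operators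
  `π.heckeOpGL … U q g = [U g U]` (the tree's `heckeOperator`) and
  **`π.heckeTGL … U q w j = T_{w,j}`** with the SAME elements `BigHeckeGLn.heckeElement n F w j` as the
  Betti-side `ResGLnCohomology.heckeT` / `ParallelWeight.heckeT`; `heckeOpGL_apply_mem`,
  `heckeOpGLLevel`, `coe_heckeOpGLLevel_apply` — for `U` compact open they preserve the
  `U`-invariants [cite: Harder1987, §3.1];
* `CuspidalAutomorphicRepData.cohomologyWt_eq_cohomologyGL`, `cohomologyWtRep_eq_cohomologyGLRep` —
  the parallel-weight objects of `CuspidalCohomologyArchCoeff` ARE the case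
  `E = (restrictK E_wt, archCoeffLie)` (definitional);
* `CuspidalAutomorphicRepData.cohomologyLam π λ q`, `cohomologyLamRep`, `cohomologyLamLevel`,
  `heckeTLam` — the case `E = E_λ(ℂ)` of a general weight family
  `λ : (F →+* ℂ) → Fin n → ℤ` (`ResGLnCohomology.archCoeffRep / archCoeffLie / isGKModule_archCoeff`),
  the automorphic side of the comparison with `ResGLnCohomology.levelCohomology ℂ n F 𝔫 λ q`.

What is NOT here (no carrier in the tree): the comparison map to `ResGLnCohomology.levelCohomology`
(de Rham / Borel–Wallach VII 2.7, Borel's regularization) and the non-vanishing of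
`H^q(𝔤, K_∞; π ⊗ E_λ ⊗ ε)` for `π` of cohomological type (Clozel's Lemme 3.14).

## Mathlib / Literature search

Tree: `AutomorphicRepData.gkCohomologyWith / cohomologyRepWith / cohomologyRepWith_isSmooth`
(`AutomorphicRepCohomologyCoeff`), `AutomorphyDatum.isRegular_gl`, `AutomorphicRepData.lieRep /
hasLieAction_lieRep`, `heckeOperator`, `heckeOperator_apply_mem_fixedPoints`,
`isHeckeTriple_top_of_isCompact_isOpen`, `finite_orbit_quotient`, `GLn.continuous_ofFinite`,
`CuspidalAutomorphicRepData.cohomologyWt/cohomologyWtRep` (`CuspidalCohomologyArchCoeff`),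
`ResGLnCohomology.archCoeffRep/archCoeffLie/isGKModule_archCoeff` (`ResGLnArchCoefficientModule`).
`lean search 'cohomologyGL|heckeTGL|cohomologyLam'`: nothing prior.

## References

* A. Borel, H. Jacquet, *Automorphic forms and automorphic representations*, Corvallis (1979),
  4.2–4.6. [BorelJacquet1979]
* A. Borel, N. Wallach (2000), I §5.1, VII §2. [BorelWallach2000]
* G. Harder, Invent. Math. 89 (1987), §3.1. [Harder1987]
* L. Clozel, *Motifs et formes automorphes* (1990), Lemme 3.14–3.15, §3.5. [Clozel1990]
* H. Grobner, A. Raghuram, Int. J. Number Theory 10 (2014) = arXiv:1102.1872, §6 Rem. 27, §7.1.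
  [GrobnerRaghuram2014]
-/

noncomputable section

namespace Literature.NumberTheory.Automorphic

open scoped TensorProduct

-- Mathlib idiom (as in `GKModules`): commutator bracket on `Module.End`
attribute [local instance 100] LieRing.ofAssociativeRing

namespace AutomorphicRepData

open RealMatrixGroup
open scoped MatrixGroups Classical

variable {F : Type} [Field F] [NumberField F] {n : ℕ} {hcpt : isCompact_glFiniteIntegralLevel n F}
  (π : AutomorphicRepData (AutomorphyDatum.gl n F hcpt))
  {E : Type*} [AddCommGroup E] [Module ℂ E]
  (σK : Representation ℂ (archGroupGL n F).maximalCompact E)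
  (σ𝔤 : (archGroupGL n F).lie →ₗ⁅ℝ⁆ Module.End ℂ E)
  (hE : ∀ (k : (archGroupGL n F).maximalCompact) (X : (archGroupGL n F).lie),
    σK k ∘ₗ σ𝔤 X ∘ₗ σK k⁻¹ =
      σ𝔤 ((archGroupGL n F).Ad (Subgroup.inclusion (archGroupGL n F).maximalCompact_le_carrier k) X))

/-- **`H^q(𝔤, K_∞; π ⊗ E)`** for an automorphic representation `π = W / W'` of `GL_n(𝔸_F)`
(Borel–Jacquet model; its `(𝔤, K_∞)`-module of `K_∞`-finite vectors `kRep` / `lieRep`) and a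
coefficient `(𝔤, K_∞)`-module `E = (σK, σ𝔤)`. [cite: BorelWallach2000, I §5.1; VII §2] -/
abbrev cohomologyGL (q : ℕ) : Type _ :=
  π.gkCohomologyWith σK σ𝔤 hE (AutomorphyDatum.isRegular_gl hcpt) π.hasLieAction_lieRep q

/-- The action of `G(𝔸_f) = range GLn.ofFinite` on `H^q(𝔤, K_∞; π ⊗ E)` (by `π_f ⊗ 1` on
cochains). [cite: BorelJacquet1979, 4.6] -/
def cohomologyGLRepRange (q : ℕ) :
    Representation ℂ (AutomorphyDatum.gl n F hcpt).finiteAdelic (π.cohomologyGL σK σ𝔤 hE q) :=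
  π.cohomologyRepWith σK σ𝔤 hE (AutomorphyDatum.isRegular_gl hcpt) π.hasLieAction_lieRep q

/-- **The representation of `GL_n(𝔸_F^∞)` on `H^q(𝔤, K_∞; π ⊗ E)`** (transported along
`GLn.ofFinite : GL_n(𝔸_F^∞) → G(𝔸_f)`). [cite: BorelJacquet1979, 4.6] -/
def cohomologyGLRep (q : ℕ) :
    Representation ℂ (BigHeckeGLn.FiniteAdelicGL n F) (π.cohomologyGL σK σ𝔤 hE q) :=
  (π.cohomologyGLRepRange σK σ𝔤 hE q).comp (GLn.ofFinite n F).rangeRestrict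

/-- Unfolding. [folklore] -/
theorem cohomologyGLRep_apply (q : ℕ) (g : BigHeckeGLn.FiniteAdelicGL n F) :
    π.cohomologyGLRep σK σ𝔤 hE q g =
      π.cohomologyGLRepRange σK σ𝔤 hE q ⟨GLn.ofFinite n F g, g, rfl⟩ :=
  rfl

/-- **The `GL_n(𝔸_F^∞)`-action on `H^q(𝔤, K_∞; π ⊗ E)` is smooth.**
[cite: BorelJacquet1979, 4.6 with 4.3] -/
theorem cohomologyGLRep_isSmooth (q : ℕ) : (π.cohomologyGLRep σK σ𝔤 hE q).IsSmooth := by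
  intro x
  have h := π.cohomologyRepWith_isSmooth σK σ𝔤 hE (AutomorphyDatum.isRegular_gl hcpt)
    π.hasLieAction_lieRep q x
  have hc : Continuous (GLn.ofFinite n F).rangeRestrict :=
    (GLn.continuous_ofFinite n F).subtype_mk _
  have e : ((π.cohomologyGLRep σK σ𝔤 hE q).stabilizerSubgroup x :
      Set (BigHeckeGLn.FiniteAdelicGL n F)) =
      (fun g => (GLn.ofFinite n F).rangeRestrict g) ⁻¹'
        (((π.cohomologyGLRepRange σK σ𝔤 hE q).stabilizerSubgroup x :
            Subgroup (AutomorphyDatum.gl n F hcpt).finiteAdelic) :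
          Set (AutomorphyDatum.gl n F hcpt).finiteAdelic) := by
    ext g
    simp only [SetLike.mem_coe, Representation.mem_stabilizerSubgroup, Set.mem_preimage]
    rfl
  change IsOpen ((π.cohomologyGLRep σK σ𝔤 hE q).stabilizerSubgroup x :
    Set (BigHeckeGLn.FiniteAdelicGL n F))
  rw [e]
  exact h.preimage hc

/-! #### Level `U`: the Hecke module `H^q(𝔤, K_∞; π ⊗ E)^U` -/

variable (U : Subgroup (BigHeckeGLn.FiniteAdelicGL n F))

/-- **`H^q(𝔤, K_∞; π ⊗ E)^U`**: the `U`-invariants, for a level `U ≤ GL_n(𝔸_F^∞)`.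
[cite: Harder1987, §3.1] -/
abbrev cohomologyGLLevel (q : ℕ) : Submodule ℂ (π.cohomologyGL σK σ𝔤 hE q) :=
  (π.cohomologyGLRep σK σ𝔤 hE q).fixedPoints U

/-- The Hecke operator `[U g U] = ∑_{yU ⊆ UgU} y` on `H^q(𝔤, K_∞; π ⊗ E)` (the tree's
`heckeOperator`). [folklore] -/
abbrev heckeOpGL (q : ℕ) (g : BigHeckeGLn.FiniteAdelicGL n F) :
    Module.End ℂ (π.cohomologyGL σK σ𝔤 hE q) :=
  heckeOperator (π.cohomologyGLRep σK σ𝔤 hE q) U g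

/-- **`T_{w,j} = [U t_{w,j} U]`** on `H^q(𝔤, K_∞; π ⊗ E)`, with the same elements
`t_{w,j} = BigHeckeGLn.heckeElement n F w j` as the Betti-side `ResGLnCohomology.heckeT` /
`ParallelWeight.heckeT`. [cite: Harder1987, §3.1] -/
abbrev heckeTGL (q : ℕ)
    (w : IsDedekindDomain.HeightOneSpectrum (_root_.NumberField.RingOfIntegers F)) (j : ℕ) :
    Module.End ℂ (π.cohomologyGL σK σ𝔤 hE q) :=
  π.heckeOpGL σK σ𝔤 hE U q (BigHeckeGLn.heckeElement n F w j)

/-- For `U` compact open the Hecke operators preserve the `U`-invariants. [folklore] -/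
theorem heckeOpGL_apply_mem (hUo : IsOpen (U : Set (BigHeckeGLn.FiniteAdelicGL n F)))
    (hUc : IsCompact (U : Set (BigHeckeGLn.FiniteAdelicGL n F))) (q : ℕ)
    (g : BigHeckeGLn.FiniteAdelicGL n F) {v : π.cohomologyGL σK σ𝔤 hE q}
    (hv : v ∈ π.cohomologyGLLevel σK σ𝔤 hE U q) :
    π.heckeOpGL σK σ𝔤 hE U q g v ∈ π.cohomologyGLLevel σK σ𝔤 hE U q := by
  haveI := isHeckeTriple_top_of_isCompact_isOpen U hUc hUo
  exact heckeOperator_apply_mem_fixedPoints _ U g hv (finite_orbit_quotient U g)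

/-- **The Hecke operator `[U g U]` on the level-`U` piece `H^q(𝔤, K_∞; π ⊗ E)^U`**
(`U` compact open). [folklore] -/
def heckeOpGLLevel (hUo : IsOpen (U : Set (BigHeckeGLn.FiniteAdelicGL n F)))
    (hUc : IsCompact (U : Set (BigHeckeGLn.FiniteAdelicGL n F))) (q : ℕ)
    (g : BigHeckeGLn.FiniteAdelicGL n F) : Module.End ℂ (π.cohomologyGLLevel σK σ𝔤 hE U q) :=
  (π.heckeOpGL σK σ𝔤 hE U q g).restrict fun _ hv => π.heckeOpGL_apply_mem σK σ𝔤 hE U hUo hUc q g hv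

/-- Unfolding. [folklore] -/
@[simp] theorem coe_heckeOpGLLevel_apply (hUo : IsOpen (U : Set (BigHeckeGLn.FiniteAdelicGL n F)))
    (hUc : IsCompact (U : Set (BigHeckeGLn.FiniteAdelicGL n F))) (q : ℕ)
    (g : BigHeckeGLn.FiniteAdelicGL n F) (v : π.cohomologyGLLevel σK σ𝔤 hE U q) :
    (π.heckeOpGLLevel σK σ𝔤 hE U hUo hUc q g v : π.cohomologyGL σK σ𝔤 hE q) =
      π.heckeOpGL σK σ𝔤 hE U q g v :=
  rfl

end AutomorphicRepData

/-! ### The parallel-weight case is `CuspidalCohomologyArchCoeff` -/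

namespace CuspidalAutomorphicRepData

open RealMatrixGroup ParallelWeight
open scoped MatrixGroups Classical

variable {F : Type} [Field F] [NumberField F] {n : ℕ} {hcpt : isCompact_glFiniteIntegralLevel n F}
  (π : CuspidalAutomorphicRepData n F hcpt)

/-- `H^q(𝔤, K_∞; π ⊗ E_wt(ℂ))` of `CuspidalCohomologyArchCoeff` is `cohomologyGL` at
`E = E_wt(ℂ)` (definitional). [folklore] -/
theorem cohomologyWt_eq_cohomologyGL (wt : Fin n → ℤ) (q : ℕ) :
    π.cohomologyWt wt q =
      π.1.cohomologyGL (restrictK (archGroupGL n F) (archCoeffRep F n wt)) (archCoeffLie F n wt)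
        (isGKModule_archCoeff F n wt).ad_compat q :=
  rfl

/-- Likewise for the `GL_n(𝔸_F^∞)`-actions. [folklore] -/
theorem cohomologyWtRep_eq_cohomologyGLRep (wt : Fin n → ℤ) (q : ℕ) :
    π.cohomologyWtRep wt q =
      π.1.cohomologyGLRep (restrictK (archGroupGL n F) (archCoeffRep F n wt)) (archCoeffLie F n wt)
        (isGKModule_archCoeff F n wt).ad_compat q :=
  rfl

/-! ### General weight families `λ = (λ_τ)_τ`: `H^q(𝔤, K_∞; π ⊗ E_λ(ℂ))` -/

variable (lam : (F →+* ℂ) → Fin n → ℤ)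

/-- **`H^q(𝔤, K_∞; π ⊗ E_λ(ℂ))`** for a cuspidal `π` of `GL_n(𝔸_F)` and a general weight family
`λ : (F →+* ℂ) → Fin n → ℤ` (coefficients `ResGLnCohomology.archCoeffRep n F λ`): the automorphic
side of the Eichler–Shimura–Borel comparison with `ResGLnCohomology.levelCohomology ℂ n F 𝔫 λ q`.
[cite: Clozel1990, Lemme 3.15 and §3.5] [cite: GrobnerRaghuram2014, §7.1–7.3] -/
abbrev cohomologyLam (q : ℕ) : Type _ :=
  π.1.cohomologyGL (restrictK (archGroupGL n F) (ResGLnCohomology.archCoeffRep n F lam))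
    (ResGLnCohomology.archCoeffLie n F lam) (ResGLnCohomology.isGKModule_archCoeff n F lam).ad_compat q

/-- **The smooth representation of `GL_n(𝔸_F^∞)` on `H^q(𝔤, K_∞; π ⊗ E_λ(ℂ))`.**
[cite: BorelJacquet1979, 4.6] -/
abbrev cohomologyLamRep (q : ℕ) :
    Representation ℂ (BigHeckeGLn.FiniteAdelicGL n F) (π.cohomologyLam lam q) :=
  π.1.cohomologyGLRep (restrictK (archGroupGL n F) (ResGLnCohomology.archCoeffRep n F lam))
    (ResGLnCohomology.archCoeffLie n F lam) (ResGLnCohomology.isGKModule_archCoeff n F lam).ad_compat q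

/-- It is smooth. [cite: BorelJacquet1979, 4.6 with 4.3] -/
theorem cohomologyLamRep_isSmooth (q : ℕ) : (π.cohomologyLamRep lam q).IsSmooth :=
  π.1.cohomologyGLRep_isSmooth _ _ _ q

variable (U : Subgroup (BigHeckeGLn.FiniteAdelicGL n F))

/-- **`H^q(𝔤, K_∞; π ⊗ E_λ(ℂ))^U`.** [cite: GrobnerRaghuram2014, §7.2] -/
abbrev cohomologyLamLevel (q : ℕ) : Submodule ℂ (π.cohomologyLam lam q) :=
  π.1.cohomologyGLLevel (restrictK (archGroupGL n F) (ResGLnCohomology.archCoeffRep n F lam))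
    (ResGLnCohomology.archCoeffLie n F lam) (ResGLnCohomology.isGKModule_archCoeff n F lam).ad_compat U q

/-- **`T_{w,j} = [U t_{w,j} U]` on `H^q(𝔤, K_∞; π ⊗ E_λ(ℂ))`**, same elements as
`ResGLnCohomology.heckeT`. [cite: Clozel1990, §3.5 (p. 123)] -/
abbrev heckeTLam (q : ℕ)
    (w : IsDedekindDomain.HeightOneSpectrum (_root_.NumberField.RingOfIntegers F)) (j : ℕ) :
    Module.End ℂ (π.cohomologyLam lam q) :=
  π.1.heckeTGL (restrictK (archGroupGL n F) (ResGLnCohomology.archCoeffRep n F lam))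
    (ResGLnCohomology.archCoeffLie n F lam) (ResGLnCohomology.isGKModule_archCoeff n F lam).ad_compat U q
    w j

end CuspidalAutomorphicRepData

end Literature.NumberTheory.Automorphic
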